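import Summits.HodgeConjecture.HodgeConjecture.Theses.NikulinTwinTransport
import HarnessLib

/-!
# Route NikulinTwinTransport · crux X = `TwinSimilitudeAlgebraic` (stmt-HodgeConjecture-13674) —
# the residual split by endomorphism type (crux-strategist, 2026-08-17)

X (`Sim₂(K3)`: every rational, type-preserving Hodge `2`-similitude `ψ : H²(S′) → H²(S)` between
projective K3 surfaces is algebraic) is PROVED on the HK-Nikulin sector and at every pair with a
CM-norm-2 twin (Theorems `…HKTargetTheorem`, `…HKNamedFacts`, `…CMNormTwins`, `…CMNormFromIsometries`,
modulo named facts and Buskin's theorem = item 13675), and OPEN on the residual.  By Zarhin's theorem the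
endomorphism algebra `E = End_Hdg(T(S)_ℚ)` of a projective K3 surface is either a totally real field or
a CM field [Zarhin 1983, Thm. 1.5.1; Huybrechts, *Lectures on K3 Surfaces*, Ch. 3 Thm. 3.7], and `E` is
CM iff `H²(S, ℚ)` carries a rational Hodge ISOMETRY acting on `H^{2,0}` by a non-real scalar (the
norm-one torus of a CM field has non-real rational points `z/z̄`; an isometry with the period as
eigenvector is automatically type-preserving).  This file records the corresponding DECOMPOSITION of X
into two sub-statements with disjoint hypotheses and different toolboxes (see the crux's
`STRATEGY-CENSUS.md` §4):

* `TwinSimilitudeTotallyReal` — X for targets `S` with NO such isometry (`E` totally real: the very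
  general pair of every twin family, `E = ℚ`, and the real-multiplication families);
* `TwinSimilitudeCM` — X for targets `S` WITH such an isometry (`E` a CM field: countably many pairs, all
  defined over number fields; contains the proved CM-norm-2 locus and the open CM pairs with
  `2 ∉ N_{E/E₀}(E^×)`, e.g. the twins of Kondō's order-66 surface).

The glue `twinSimilitudeAlgebraic_of_subs : TwinSimilitudeTotallyReal → TwinSimilitudeCM → X` is the
propositional case split; both pieces are implied by X (`…_of_twinSimilitudeAlgebraic`), so X is
equivalent to their conjunction (the split loses nothing).  Statements are
spelled with fully qualified names, VERBATIM the body of the route item `TwinSimilitudeAlgebraic` with one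
hypothesis inserted, so that a route-level split (`ledger route edit --split TwinSimilitudeAlgebraic`) can use
this theorem by `--glue-by` (the children unfold to these terms). [cite: Zarhin1983HodgeGroupsK3, Thm. 1.5.1]
[cite: Huybrechts2016K3, Ch. 3 Thm. 3.7 and Rem. 3.10] [cite: Varesco2023, §0.1]
-/

-- `Summit.HodgeConjecture.HodgeConjecture.…` (summit = problem) duplicates a namespace component by design (D-0017).
set_option linter.dupNamespace false

noncomputable section

open scoped Manifold

namespace Summit.HodgeConjecture.HodgeConjecture.Theorems.NikulinTwinTransport

open Summit.HodgeConjecture.HodgeConjecture.Theses.NikulinTwinTransport (TwinSimilitudeAlgebraic)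

/-- **X on the totally real side**: the body of the route item `TwinSimilitudeAlgebraic` with the extra
hypothesis that the target `S` carries NO rational cup-isometry of `H²(S(ℂ); ℂ)` with a non-real
eigenvalue on a non-zero `(2,0)`-class (i.e. `End_Hdg(T(S)_ℚ)` is totally real, Zarhin's first case).
Contains the very general pair of every twin family (`E = ℚ`); the open core of X.
[cite: Zarhin1983HodgeGroupsK3, Thm. 1.5.1] [cite: VanGeemenSchuett2023, Rem. 4.9] -/
@[conjecture] def TwinSimilitudeTotallyReal : Prop :=
  ∀ (μ : Literature.AlgebraicGeometry.HodgeTheory.OrientationFamily), μ.HasPoincareDuality → ∀ (S S' : Literature.AlgebraicGeometry.Motives.SchemeOver ℂ) (hS : (Literature.AlgebraicGeometry.Motives.IsSmoothProjective 2 S ∧ Subsingleton (Literature.AlgebraicGeometry.Motives.structureSheafCohomology S.left 1) ∧ ∃ (A : Literature.AlgebraicGeometry.HodgeTheory.HodgeModel 2 S) (η : Literature.Geometry.Kaehler.MForm 𝓘(ℝ, A.model) A.carrier ℂ 2), Literature.Geometry.Kaehler.IsHolomorphicInCharts η ∧ ∀ x, η x ≠ 0)) (hS' : (Literature.AlgebraicGeometry.Motives.IsSmoothProjective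 2 S' ∧ Subsingleton (Literature.AlgebraicGeometry.Motives.structureSheafCohomology S'.left 1) ∧ ∃ (A : Literature.AlgebraicGeometry.HodgeTheory.HodgeModel 2 S') (η : Literature.Geometry.Kaehler.MForm 𝓘(ℝ, A.model) A.carrier ℂ 2), Literature.Geometry.Kaehler.IsHolomorphicInCharts η ∧ ∀ x, η x ≠ 0)) (p : Literature.AlgebraicGeometry.HodgeTheory.complexBetti S (2 * 2)) (p' : Literature.AlgebraicGeometry.HodgeTheory.complexBetti S' (2 * 2)), (Literature.AlgebraicGeometry.HodgeTheory.IsIntegralClass p ∧ ∀ q : Literature.AlgebraicGeometry.HodgeTheory.complexBetti S (2 * 2), Literature.AlgebraicGeometry.HodgeTheory.IsIntegralClass q → ∃ n : ℤ, q = n • p) → (Literature.AlgebraicGeometry.HodgeTheory.IsIntegralClass p' ∧ ∀ q : Literature.AlgebraicGeometry.HodgeTheory.complexBetti S' (2 * 2), Literature.AlgebraicGeometry.HodgeTheory.IsIntegralClass q → ∃ n : ℤ, q = n • p') → ∀ (ψ : Literature.AlgebraicGeometry.HodgeTheory.complexBetti S' (2 * 1) →ₗ[ℂ] Literature.AlgebraicGeometry.HodgeTheory.complexBetti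 S (2 * 1)), (∀ x, Literature.AlgebraicGeometry.HodgeTheory.IsRationalClass x → Literature.AlgebraicGeometry.HodgeTheory.IsRationalClass (ψ x)) → (∀ (i j : ℕ) x, Literature.AlgebraicGeometry.HodgeTheory.IsOfHodgeType 2 S' (2 * 1) i j x → Literature.AlgebraicGeometry.HodgeTheory.IsOfHodgeType 2 S (2 * 1) i j (ψ x)) → (∀ (x y : Literature.AlgebraicGeometry.HodgeTheory.complexBetti S' (2 * 1)) (a : ℂ), Literature.AlgebraicTopology.SingularHomology.cupProduct (rfl : 2 * 1 + 2 * 1 = 2 * 2) x y = a • p' → Literature.AlgebraicTopology.SingularHomology.cupProduct (rfl : 2 * 1 + 2 * 1 = 2 * 2) (ψ x) (ψ y) = ((2 : ℂ) * a) • p) → ¬ (∃ f : Literature.AlgebraicGeometry.HodgeTheory.complexBetti S (2 * 1) →ₗ[ℂ] Literature.AlgebraicGeometry.HodgeTheory.complexBetti S (2 * 1), (∀ x, Literature.AlgebraicGeometry.HodgeTheory.IsRationalClass x → Literature.AlgebraicGeometry.HodgeTheory.IsRationalClass (f x)) ∧ (∀ (x y : Literature.AlgebraicGeometry.HodgeTheory.complexBetti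 S (2 * 1)) (a : ℂ), Literature.AlgebraicTopology.SingularHomology.cupProduct (rfl : 2 * 1 + 2 * 1 = 2 * 2) x y = a • p → Literature.AlgebraicTopology.SingularHomology.cupProduct (rfl : 2 * 1 + 2 * 1 = 2 * 2) (f x) (f y) = a • p) ∧ ∃ (σ : Literature.AlgebraicGeometry.HodgeTheory.complexBetti S (2 * 1)) (t : ℂ), Literature.AlgebraicGeometry.HodgeTheory.IsOfHodgeType 2 S (2 * 1) 2 0 σ ∧ σ ≠ 0 ∧ t.im ≠ 0 ∧ f σ = t • σ) → ∃ γ ∈ Literature.AlgebraicGeometry.HodgeTheory.algebraicClasses (CategoryTheory.MonoidalCategoryStruct.tensorObj S S') 2, ∀ x : Literature.AlgebraicGeometry.HodgeTheory.complexBetti S' (2 * 1), ψ x = Literature.AlgebraicGeometry.HodgeTheory.complexGysin μ (Literature.AlgebraicGeometry.Motives.IsSmoothProjective.tensor_holds hS.1 hS'.1) hS.1 (CategoryTheory.SemiCartesianMonoidalCategory.fst S S') (rfl : 2 * 1 + 2 * 2 + 2 * 2 = 2 * 1 + 2 * (2 + 2)) (Literature.AlgebraicTopology.SingularHomology.cupProduct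 (rfl : 2 * 1 + 2 * 2 = 2 * 1 + 2 * 2) (Literature.AlgebraicGeometry.HodgeTheory.complexBetti.map (CategoryTheory.SemiCartesianMonoidalCategory.snd S S') (2 * 1) x) γ)

/-- **X on the CM side**: the body of the route item `TwinSimilitudeAlgebraic` with the extra hypothesis
that the target `S` DOES carry a rational cup-isometry with a non-real eigenvalue on a non-zero
`(2,0)`-class (i.e. `End_Hdg(T(S)_ℚ)` is a CM field, Zarhin's second case).  Contains the proved
CM-norm-2 locus (`…CMNormFromIsometries`); open for CM fields `E` with `2 ∉ N_{E/E₀}(E^×)`.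
[cite: Zarhin1983HodgeGroupsK3, Thm. 1.5.1] [cite: Huybrechts2019, Cor. 0.4 (ii)] -/
@[conjecture] def TwinSimilitudeCM : Prop :=
  ∀ (μ : Literature.AlgebraicGeometry.HodgeTheory.OrientationFamily), μ.HasPoincareDuality → ∀ (S S' : Literature.AlgebraicGeometry.Motives.SchemeOver ℂ) (hS : (Literature.AlgebraicGeometry.Motives.IsSmoothProjective 2 S ∧ Subsingleton (Literature.AlgebraicGeometry.Motives.structureSheafCohomology S.left 1) ∧ ∃ (A : Literature.AlgebraicGeometry.HodgeTheory.HodgeModel 2 S) (η : Literature.Geometry.Kaehler.MForm 𝓘(ℝ, A.model) A.carrier ℂ 2), Literature.Geometry.Kaehler.IsHolomorphicInCharts η ∧ ∀ x, η x ≠ 0)) (hS' : (Literature.AlgebraicGeometry.Motives.IsSmoothProjective 2 S' ∧ Subsingleton (Literature.AlgebraicGeometry.Motives.structureSheafCohomology S'.left 1) ∧ ∃ (A : Literature.AlgebraicGeometry.HodgeTheory.HodgeModel 2 S') (η : Literature.Geometry.Kaehler.MForm 𝓘(ℝ, A.model) A.carrier ℂ 2), Literature.Geometry.Kaehler.IsHolomorphicInCharts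 η ∧ ∀ x, η x ≠ 0)) (p : Literature.AlgebraicGeometry.HodgeTheory.complexBetti S (2 * 2)) (p' : Literature.AlgebraicGeometry.HodgeTheory.complexBetti S' (2 * 2)), (Literature.AlgebraicGeometry.HodgeTheory.IsIntegralClass p ∧ ∀ q : Literature.AlgebraicGeometry.HodgeTheory.complexBetti S (2 * 2), Literature.AlgebraicGeometry.HodgeTheory.IsIntegralClass q → ∃ n : ℤ, q = n • p) → (Literature.AlgebraicGeometry.HodgeTheory.IsIntegralClass p' ∧ ∀ q : Literature.AlgebraicGeometry.HodgeTheory.complexBetti S' (2 * 2), Literature.AlgebraicGeometry.HodgeTheory.IsIntegralClass q → ∃ n : ℤ, q = n • p') → ∀ (ψ : Literature.AlgebraicGeometry.HodgeTheory.complexBetti S' (2 * 1) →ₗ[ℂ] Literature.AlgebraicGeometry.HodgeTheory.complexBetti S (2 * 1)), (∀ x, Literature.AlgebraicGeometry.HodgeTheory.IsRationalClass x → Literature.AlgebraicGeometry.HodgeTheory.IsRationalClass (ψ x)) → (∀ (i j : ℕ) x, Literature.AlgebraicGeometry.HodgeTheory.IsOfHodgeType 2 S' (2 * 1) i j x → Literature.AlgebraicGeometry.HodgeTheory.IsOfHodgeType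 2 S (2 * 1) i j (ψ x)) → (∀ (x y : Literature.AlgebraicGeometry.HodgeTheory.complexBetti S' (2 * 1)) (a : ℂ), Literature.AlgebraicTopology.SingularHomology.cupProduct (rfl : 2 * 1 + 2 * 1 = 2 * 2) x y = a • p' → Literature.AlgebraicTopology.SingularHomology.cupProduct (rfl : 2 * 1 + 2 * 1 = 2 * 2) (ψ x) (ψ y) = ((2 : ℂ) * a) • p) → (∃ f : Literature.AlgebraicGeometry.HodgeTheory.complexBetti S (2 * 1) →ₗ[ℂ] Literature.AlgebraicGeometry.HodgeTheory.complexBetti S (2 * 1), (∀ x, Literature.AlgebraicGeometry.HodgeTheory.IsRationalClass x → Literature.AlgebraicGeometry.HodgeTheory.IsRationalClass (f x)) ∧ (∀ (x y : Literature.AlgebraicGeometry.HodgeTheory.complexBetti S (2 * 1)) (a : ℂ), Literature.AlgebraicTopology.SingularHomology.cupProduct (rfl : 2 * 1 + 2 * 1 = 2 * 2) x y = a • p → Literature.AlgebraicTopology.SingularHomology.cupProduct (rfl : 2 * 1 + 2 * 1 = 2 * 2) (f x) (f y) = a • p) ∧ ∃ (σ : Literature.AlgebraicGeometry.HodgeTheory.complexBetti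 S (2 * 1)) (t : ℂ), Literature.AlgebraicGeometry.HodgeTheory.IsOfHodgeType 2 S (2 * 1) 2 0 σ ∧ σ ≠ 0 ∧ t.im ≠ 0 ∧ f σ = t • σ) → ∃ γ ∈ Literature.AlgebraicGeometry.HodgeTheory.algebraicClasses (CategoryTheory.MonoidalCategoryStruct.tensorObj S S') 2, ∀ x : Literature.AlgebraicGeometry.HodgeTheory.complexBetti S' (2 * 1), ψ x = Literature.AlgebraicGeometry.HodgeTheory.complexGysin μ (Literature.AlgebraicGeometry.Motives.IsSmoothProjective.tensor_holds hS.1 hS'.1) hS.1 (CategoryTheory.SemiCartesianMonoidalCategory.fst S S') (rfl : 2 * 1 + 2 * 2 + 2 * 2 = 2 * 1 + 2 * (2 + 2)) (Literature.AlgebraicTopology.SingularHomology.cupProduct (rfl : 2 * 1 + 2 * 2 = 2 * 1 + 2 * 2) (Literature.AlgebraicGeometry.HodgeTheory.complexBetti.map (CategoryTheory.SemiCartesianMonoidalCategory.snd S S') (2 * 1) x) γ)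

/-- **The split glue** (propositional case analysis on the CM-type predicate of the target):
`TwinSimilitudeTotallyReal → TwinSimilitudeCM → TwinSimilitudeAlgebraic`. [folklore] -/
theorem twinSimilitudeAlgebraic_of_subs :
    TwinSimilitudeTotallyReal → TwinSimilitudeCM → TwinSimilitudeAlgebraic := by
  intro hTR hCM μ hμ S S' hS hS' p p' hp hp' ψ h₁ h₂ h₃
  by_cases hc : (∃ f : Literature.AlgebraicGeometry.HodgeTheory.complexBetti S (2 * 1) →ₗ[ℂ] Literature.AlgebraicGeometry.HodgeTheory.complexBetti S (2 * 1), (∀ x, Literature.AlgebraicGeometry.HodgeTheory.IsRationalClass x → Literature.AlgebraicGeometry.HodgeTheory.IsRationalClass (f x)) ∧ (∀ (x y : Literature.AlgebraicGeometry.HodgeTheory.complexBetti S (2 * 1)) (a : ℂ), Literature.AlgebraicTopology.SingularHomology.cupProduct (rfl : 2 * 1 + 2 * 1 = 2 * 2) x y = a • p → Literature.AlgebraicTopology.SingularHomology.cupProduct (rfl : 2 * 1 + 2 * 1 = 2 * 2) (f x) (f y) = a • p) ∧ ∃ (σ : Literature.AlgebraicGeometry.HodgeTheory.complexBetti S (2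 * 1)) (t : ℂ), Literature.AlgebraicGeometry.HodgeTheory.IsOfHodgeType 2 S (2 * 1) 2 0 σ ∧ σ ≠ 0 ∧ t.im ≠ 0 ∧ f σ = t • σ)
  · exact hCM μ hμ S S' hS hS' p p' hp hp' ψ h₁ h₂ h₃ hc
  · exact hTR μ hμ S S' hS hS' p p' hp hp' ψ h₁ h₂ h₃ hc

/-- The totally real piece is weaker than X. [folklore] -/
theorem twinSimilitudeTotallyReal_of_twinSimilitudeAlgebraic (h : TwinSimilitudeAlgebraic) :
    TwinSimilitudeTotallyReal :=
  fun μ hμ S S' hS hS' p p' hp hp' ψ h₁ h₂ h₃ _ => h μ hμ S S' hS hS' p p' hp hp' ψ h₁ h₂ h₃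

/-- The CM piece is weaker than X. [folklore] -/
theorem twinSimilitudeCM_of_twinSimilitudeAlgebraic (h : TwinSimilitudeAlgebraic) :
    TwinSimilitudeCM :=
  fun μ hμ S S' hS hS' p p' hp hp' ψ h₁ h₂ h₃ _ => h μ hμ S S' hS hS' p p' hp hp' ψ h₁ h₂ h₃

end Summit.HodgeConjecture.HodgeConjecture.Theorems.NikulinTwinTransport

end
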